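import Mathlib
import Summits.ValiantsHypothesis.ValiantsHypothesis.Theorems.ChowBorderDepth3ChowBorderBoundDefs
import Literature.Computability.AlgebraicComplexity.PermanentIrreducible

/-!
# Stub `stub_monomialLowerBound` of crux `ChowBorderDepth3.ChowBorderBound`
# (stmt-ValiantsHypothesis-5936), line `registered` — part 1: the monomial formula

Helper file (calculus) for the registered stub `stub_monomialLowerBound` (W5), proved in
`ChowBorderDepth3ChowBorderBoundMonomialLowerBound.lean`: the quotient-derivative numerators
`quotDerivNum f g w = g^(|w|+1) · ∂_w (f / g)` of a MONOMIAL numerator over a MONOMIAL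
denominator, and of the permanent `perₙ = ∑_ρ x^(μ_ρ)` over a monomial denominator `κ x^β`.

* **Vanishing.**  Partial derivatives commute (`pderiv_pderiv_comm`), so if neither `f` nor `g`
  involves the variable `v` then no `quotDerivNum f g w` does, and `quotDerivNum f g w = 0` as
  soon as `v ∈ w` (`quotDerivNum_eq_zero_of_mem`).
* **Key formula** (`quotDerivNum_monomial`).  For an injective word `l`,
  `quotDerivNum x^μ (κ x^β) l = κ^|l| · ∏_{v ∈ l} (μ v − β v) · x^E` whenever the exponent `E`
  satisfies `E w + [w ∈ l] = μ w + |l| · β w` pointwise (such an honest `E` exists iff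
  `μ v + β v ≥ 1` for every letter `v`).  Induction on the word: one quotient-rule step maps
  `c · x^E` to `κ c (E v − (k+1) β v) · x^(E + β − e_v)`, and `E v = μ v + k β v` for a new letter.
* **The permanent** (`quotDerivNum_permMonomial`, `coeff_quotDerivNum_perPoly`): by additivity the
  numerator of `perₙ / (κ x^β)` along an injective word `u` of length `s` is the sum over the
  permutations `ρ`; an honest `ρ` (`μ_ρ + β ≥ 1` on the letters) contributes
  `κ^s ∏_k (μ_ρ (u k) − β (u k)) · x^(μ_ρ + s β − 1_u)`, a `ρ` missing a letter outside the support
  of `β` contributes `0`.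
* A family of polynomials with private witness monomials is linearly independent
  (`linearIndependent_of_coeff_witness`).

References: P. Dutta, P. Dwivedi, N. Saxena, *Demystifying the border of depth-3 algebraic
circuits*, FOCS 2021 (DiDIL, §3); folklore calculus.
-/

-- `Summit.ValiantsHypothesis.ValiantsHypothesis.…` is the tree's mandated single-conjunct layout
-- (Sub = Summit), so the duplicated namespace component is intended.
set_option linter.dupNamespace false

namespace Summit.ValiantsHypothesis.ValiantsHypothesis.Theorems.ChowBorderBound.MonomialLowerBound

open MvPolynomial
open Summit.ValiantsHypothesis.ValiantsHypothesis.Theorems.ChowBorderBound.QuotDeriv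
open Literature.Computability.AlgebraicComplexity

/-! ### §1 Calculus of quotient-derivative numerators of monomials -/

section Calculus

variable {τ R : Type*}

/-- Partial derivatives of multivariate polynomials commute. -/
theorem pderiv_pderiv_comm [CommSemiring R] (i j : τ) (p : MvPolynomial τ R) :
    pderiv i (pderiv j p) = pderiv j (pderiv i p) := by
  classical
  rcases eq_or_ne i j with rfl | hij
  · rfl
  ext m
  simp only [coeff_pderiv, Finsupp.add_apply, Finsupp.single_apply, if_neg hij,
    if_neg hij.symm, add_zero]
  rw [add_right_comm m (Finsupp.single i 1) (Finsupp.single j 1)]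
  ring

/-- If neither the numerator `f` nor the denominator `g` involves the variable `v`
(`∂_v f = ∂_v g = 0`), then no quotient-derivative numerator `quotDerivNum f g w` does. -/
theorem pderiv_quotDerivNum_eq_zero [CommRing R] {f g : MvPolynomial τ R} {v : τ}
    (hf : pderiv v f = 0) (hg : pderiv v g = 0) :
    ∀ w : List τ, pderiv v (quotDerivNum f g w) = 0
  | [] => hf
  | a :: w => by
    have ih := pderiv_quotDerivNum_eq_zero hf hg w
    have h1 : pderiv v (pderiv a (quotDerivNum f g w)) = 0 := by
      rw [pderiv_pderiv_comm, ih, map_zero]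
    have h2 : pderiv v (pderiv a g) = 0 := by rw [pderiv_pderiv_comm, hg, map_zero]
    simp only [quotDerivNum_cons, map_sub, map_nsmul, Derivation.leibniz, h1, h2, ih, hg,
      smul_zero, add_zero, sub_zero]

/-- Consequently `quotDerivNum f g w = 0` as soon as the word `w` differentiates in a variable
occurring in neither `f` nor `g`. -/
theorem quotDerivNum_eq_zero_of_mem [CommRing R] {f g : MvPolynomial τ R} {v : τ}
    (hf : pderiv v f = 0) (hg : pderiv v g = 0) :
    ∀ w : List τ, v ∈ w → quotDerivNum f g w = 0
  | [], h => by simp at h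
  | a :: w, h => by
    rw [quotDerivNum_cons]
    rcases List.mem_cons.1 h with rfl | h
    · rw [pderiv_quotDerivNum_eq_zero hf hg w, hg, mul_zero, mul_zero, nsmul_zero, sub_zero]
    · rw [quotDerivNum_eq_zero_of_mem hf hg w h, map_zero, mul_zero, zero_mul, nsmul_zero,
        sub_zero]

/-- `x^β · ∂_v (c x^E) = c · E(v) · x^(E + β − e_v)` (both sides vanish when `E v = 0`). -/
theorem monomial_mul_pderiv_monomial [CommSemiring R] (β E : τ →₀ ℕ) (κ c : R) (v : τ) :
    monomial β κ * pderiv v (monomial E c) =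
      monomial (E + β - Finsupp.single v 1) (κ * c * (E v : R)) := by
  classical
  rw [pderiv_monomial, monomial_mul]
  rcases Nat.eq_zero_or_pos (E v) with h | h
  · simp [h]
  · have hexp : β + (E - Finsupp.single v 1) = E + β - Finsupp.single v 1 := by
      ext w
      simp only [Finsupp.add_apply, Finsupp.tsub_apply, Finsupp.single_apply]
      split_ifs with hw
      · subst hw; omega
      · omega
    rw [hexp, mul_assoc]

/-- **Key formula.**  For an injective word `l` and a monomial numerator `x^μ` over the monomial
denominator `κ x^β`: if `E` is an exponent with `E w + [w ∈ l] = μ w + |l| · β w` for all `w`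
(such an `E` exists iff `μ v + β v ≥ 1` for every letter `v` of `l`), then
`quotDerivNum x^μ (κ x^β) l = κ^|l| · ∏_{v ∈ l} (μ v − β v) · x^E`. -/
theorem quotDerivNum_monomial [CommRing R] [DecidableEq τ] (μ β : τ →₀ ℕ) (κ : R) :
    ∀ (l : List τ) (E : τ →₀ ℕ), l.Nodup →
      (∀ w, E w + (if w ∈ l then 1 else 0) = μ w + l.length * β w) →
      quotDerivNum (monomial μ 1) (monomial β κ) l =
        monomial E (κ ^ l.length * (l.map fun v => ((μ v : R) - β v)).prod)
  | [], E, _, hE => by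
    have hEμ : E = μ := Finsupp.ext fun w => by simpa using hE w
    simp [hEμ]
  | v :: l, E', hnd, hE' => by
    obtain ⟨hvl, hl⟩ := List.nodup_cons.1 hnd
    -- pointwise bookkeeping: the exponent before the last derivative is `E' + e_v - β`
    have key : ∀ w, β w ≤ E' w + (if v = w then 1 else 0) ∧
        E' w + (if v = w then 1 else 0) - β w + (if w ∈ l then 1 else 0) =
          μ w + l.length * β w := by
      intro w
      have h := hE' w
      simp only [List.mem_cons, List.length_cons, add_mul, one_mul] at h
      rcases eq_or_ne w v with rfl | hwv
      · rw [if_pos rfl, if_neg hvl]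
        rw [if_pos (Or.inl rfl)] at h
        omega
      · rw [if_neg (Ne.symm hwv)]
        by_cases hw : w ∈ l
        · rw [if_pos hw]
          rw [if_pos (Or.inr hw)] at h
          have hmul : β w ≤ l.length * β w :=
            Nat.le_mul_of_pos_left _ (List.length_pos_of_mem hw)
          omega
        · rw [if_neg hw]
          rw [if_neg (not_or.2 ⟨hwv, hw⟩)] at h
          omega
    have hE : ∀ w, (E' + Finsupp.single v 1 - β : τ →₀ ℕ) w + (if w ∈ l then 1 else 0) =
        μ w + l.length * β w := fun w => by
      simp only [Finsupp.tsub_apply, Finsupp.add_apply, Finsupp.single_apply]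
      exact (key w).2
    have hexp : E' + Finsupp.single v 1 - β + β - Finsupp.single v 1 = E' := by
      ext w
      simp only [Finsupp.tsub_apply, Finsupp.add_apply, Finsupp.single_apply]
      have h := (key w).1
      omega
    have hEv : ((E' + Finsupp.single v 1 - β : τ →₀ ℕ) v : R) =
        (μ v : R) + (l.length : R) * (β v : R) := by
      have h := hE v
      rw [if_neg hvl, add_zero] at h
      rw [h, Nat.cast_add, Nat.cast_mul]
    rw [quotDerivNum_cons, quotDerivNum_monomial μ β κ l _ hl hE, monomial_mul_pderiv_monomial,
      monomial_mul_pderiv_monomial, add_comm β (E' + Finsupp.single v 1 - β),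
      ← Nat.cast_smul_eq_nsmul R, smul_monomial, smul_eq_mul, ← map_sub, hexp]
    refine congrArg (monomial E') ?_
    simp only [List.length_cons, List.map_cons, List.prod_cons, pow_succ]
    rw [hEv]
    push_cast
    ring

/-- `quotDerivNum` is additive in the numerator: finite sums. -/
theorem quotDerivNum_finset_sum [CommRing R] {ι : Type*} (s : Finset ι)
    (f : ι → MvPolynomial τ R) (g : MvPolynomial τ R) (w : List τ) :
    quotDerivNum (∑ i ∈ s, f i) g w = ∑ i ∈ s, quotDerivNum (f i) g w := by
  classical
  induction s using Finset.induction_on with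
  | empty => simp
  | insert a s ha ih => rw [Finset.sum_insert ha, Finset.sum_insert ha, quotDerivNum_add, ih]

/-- A family of polynomials with "private" witness monomials — `x^(m i)` occurs in `F i` and in no
other `F j` — is linearly independent (extract the coefficient of `x^(m i)`). -/
theorem linearIndependent_of_coeff_witness {ι K : Type*} [Field K] [Fintype ι]
    (F : ι → MvPolynomial τ K) (m : ι → τ →₀ ℕ) (hdiag : ∀ i, coeff (m i) (F i) ≠ 0)
    (hoff : ∀ i j, i ≠ j → coeff (m i) (F j) = 0) : LinearIndependent K F := by
  rw [Fintype.linearIndependent_iff]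
  intro c hc i
  have h := congrArg (coeff (m i)) hc
  rw [coeff_sum, coeff_zero, Finset.sum_eq_single i] at h
  · rw [coeff_smul, smul_eq_mul] at h
    exact (mul_eq_zero.1 h).resolve_right (hdiag i)
  · intro j _ hji
    rw [coeff_smul, hoff i j (Ne.symm hji), smul_zero]
  · intro hi
    exact absurd (Finset.mem_univ i) hi

end Calculus

/-! ### §2 The numerators of `perₙ / (κ x^β)` along injective words -/

section Permanent

variable {n s : ℕ}

/-- `μ_ρ v = [ρ v.2 = v.1]` (cells are `(row, column)`, `ρ` occupies the cells `(ρ c, c)`). -/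
theorem permMonomial_apply' (ρ : Equiv.Perm (Fin n)) (v : Fin n × Fin n) :
    permMonomial ρ v = if ρ v.2 = v.1 then 1 else 0 := by
  obtain ⟨r, c⟩ := v
  exact permMonomial_apply ρ r c

/-- The indicator of an injective word. -/
theorem sum_single_apply (u : Fin s → Fin n × Fin n) (hu : Function.Injective u)
    (w : Fin n × Fin n) :
    (∑ k, Finsupp.single (u k) (1 : ℕ)) w = if ∃ k, u k = w then 1 else 0 := by
  rw [Finsupp.finsetSum_apply]
  simp only [Finsupp.single_apply]
  split_ifs with h
  · obtain ⟨k, rfl⟩ := h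
    rw [Finset.sum_eq_single k]
    · rw [if_pos rfl]
    · intro k' _ hk'
      exact if_neg fun h' => hk' (hu h')
    · intro hk
      exact absurd (Finset.mem_univ k) hk
  · push Not at h
    exact Finset.sum_eq_zero fun k _ => if_neg (h k)

/-- Pointwise characterisation of the exponent `μ_ρ + s β − 1_u` of the word `u` for an honest
permutation `ρ` (`μ_ρ + β ≥ 1` on the letters): `E w + [w ∈ u] = μ_ρ w + s β w`. -/
theorem exponent_spec (β : Fin n × Fin n →₀ ℕ) (u : Fin s → Fin n × Fin n)
    (hu : Function.Injective u) (ρ : Equiv.Perm (Fin n))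
    (hgood : ∀ k, 1 ≤ permMonomial ρ (u k) + β (u k)) (w : Fin n × Fin n) :
    (permMonomial ρ + s • β - ∑ k, Finsupp.single (u k) 1 : Fin n × Fin n →₀ ℕ) w +
        (if ∃ k, u k = w then 1 else 0) = permMonomial ρ w + s * β w := by
  simp only [Finsupp.tsub_apply, Finsupp.add_apply, Finsupp.smul_apply, smul_eq_mul,
    sum_single_apply u hu w]
  split_ifs with h
  · obtain ⟨k, rfl⟩ := h
    have h1 := hgood k
    have h2 : β (u k) ≤ s * β (u k) := Nat.le_mul_of_pos_left _ k.pos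
    omega
  · omega

/-- The numerator of `x^(μ_ρ) / (κ x^β)` along an injective word `u` for an honest `ρ`:
`κ^s · ∏_k (μ_ρ (u k) − β (u k)) · x^(μ_ρ + s β − 1_u)`. -/
theorem quotDerivNum_permMonomial (β : Fin n × Fin n →₀ ℕ) (κ : ℂ) (u : Fin s → Fin n × Fin n)
    (hu : Function.Injective u) (ρ : Equiv.Perm (Fin n))
    (hgood : ∀ k, 1 ≤ permMonomial ρ (u k) + β (u k)) :
    quotDerivNum (monomial (permMonomial ρ) 1) (C κ * monomial β 1) (List.ofFn u) =
      monomial (permMonomial ρ + s • β - ∑ k, Finsupp.single (u k) 1)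
        (κ ^ s * ∏ k, ((permMonomial ρ (u k) : ℂ) - β (u k))) := by
  rw [C_mul_monomial, mul_one]
  have h := quotDerivNum_monomial (permMonomial ρ) β κ (List.ofFn u)
    (permMonomial ρ + s • β - ∑ k, Finsupp.single (u k) 1) (List.nodup_ofFn.2 hu) ?_
  · rw [h, List.length_ofFn, List.map_ofFn, List.prod_ofFn]
    rfl
  · intro w
    rw [List.length_ofFn]
    have hw := exponent_spec β u hu ρ hgood w
    by_cases h : ∃ k, u k = w
    · rw [if_pos (List.mem_ofFn.2 h)]
      rwa [if_pos h] at hw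
    · rw [if_neg fun h' => h (List.mem_ofFn.1 h')]
      rwa [if_neg h] at hw

/-- For a dishonest `ρ` — a letter `v` of the word with `μ_ρ v = β v = 0` — the numerator of
`x^(μ_ρ) / (κ x^β)` vanishes. -/
theorem quotDerivNum_permMonomial_eq_zero (β : Fin n × Fin n →₀ ℕ) (κ : ℂ)
    (w : List (Fin n × Fin n)) (ρ : Equiv.Perm (Fin n)) (v : Fin n × Fin n) (hv : v ∈ w)
    (hρ : permMonomial ρ v = 0) (hβ : β v = 0) :
    quotDerivNum (monomial (permMonomial ρ) 1) (C κ * monomial β 1) w = 0 := by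
  refine quotDerivNum_eq_zero_of_mem ?_ ?_ w hv
  · rw [pderiv_monomial, hρ, Nat.cast_zero, mul_zero, monomial_zero]
  · rw [C_mul_monomial, pderiv_monomial, hβ, Nat.cast_zero, mul_zero, monomial_zero]

/-- The coefficients of the numerators of `perₙ / g` are sums over the permutations. -/
theorem coeff_quotDerivNum_perPoly (g : MvPolynomial (Fin n × Fin n) ℂ)
    (w : List (Fin n × Fin n)) (m : Fin n × Fin n →₀ ℕ) :
    coeff m (quotDerivNum (perPoly (Fin n) ℂ) g w) =
      ∑ ρ : Equiv.Perm (Fin n), coeff m (quotDerivNum (monomial (permMonomial ρ) 1) g w) := by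
  rw [perPoly_eq_sum_monomial, quotDerivNum_finset_sum, coeff_sum]

/-- Two honest permutations with the same exponent along the same word coincide. -/
theorem perm_eq_of_exponent_eq (β : Fin n × Fin n →₀ ℕ) (u : Fin s → Fin n × Fin n)
    (hu : Function.Injective u) (ρ ρ' : Equiv.Perm (Fin n))
    (hgood : ∀ k, 1 ≤ permMonomial ρ (u k) + β (u k))
    (hgood' : ∀ k, 1 ≤ permMonomial ρ' (u k) + β (u k))
    (hE : permMonomial ρ' + s • β - ∑ k, Finsupp.single (u k) 1 =
      permMonomial ρ + s • β - ∑ k, Finsupp.single (u k) 1) :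
    ρ' = ρ := by
  apply permMonomial_injective
  ext w
  have h1 := exponent_spec β u hu ρ' hgood' w
  have h2 := exponent_spec β u hu ρ hgood w
  rw [hE] at h1
  omega

end Permanent

/-- Registered anchor of this helper file on crux `stmt-ValiantsHypothesis-5936` (sub-goal
`stub_monomialLowerBoundFormula` of stub W5): the numerator of `x^(μ_ρ) / (κ x^β)` along an
injective word `u` for an honest permutation `ρ` is
`κ^s · ∏_k (μ_ρ (u k) − β (u k)) · x^(μ_ρ + s β − 1_u)`. -/
theorem stub_monomialLowerBoundFormula :
    ∀ (n s : ℕ) (β : (Fin n × Fin n) →₀ ℕ) (κ : ℂ) (u : Fin s → Fin n × Fin n), Function.Injective u →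
      ∀ ρ : Equiv.Perm (Fin n),
        (∀ k, 1 ≤ Literature.Computability.AlgebraicComplexity.permMonomial ρ (u k) + β (u k)) →
        Summit.ValiantsHypothesis.ValiantsHypothesis.Theorems.ChowBorderBound.QuotDeriv.quotDerivNum
            (MvPolynomial.monomial (Literature.Computability.AlgebraicComplexity.permMonomial ρ) (1 : ℂ))
            (MvPolynomial.C κ * MvPolynomial.monomial β 1) (List.ofFn u) =
          MvPolynomial.monomial
            (Literature.Computability.AlgebraicComplexity.permMonomial ρ + s • β - ∑ k, Finsupp.single (u k) 1)
            (κ ^ s * ∏ k, ((Literature.Computability.AlgebraicComplexity.permMonomial ρ (u k) : ℂ) - β (u k))) :=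
  fun _ _ β κ u hu ρ hgood => quotDerivNum_permMonomial β κ u hu ρ hgood

end Summit.ValiantsHypothesis.ValiantsHypothesis.Theorems.ChowBorderBound.MonomialLowerBound
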